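import Summits.QuantumFields.BalabanUV.Beta.RootedT2JetSingle
import Summits.QuantumFields.BalabanUV.Beta.RowD1MixedDischarged

/-!
# RootedBorderTableLaw — 33K2: an1's `(g,h)`-SYMMETRISED BOND-LEVEL BORDER REFLECTION LAW FOR `vh2Tab`, PROVED (= the
# hypothesis `hB` of BX2 `BorderLetterPacking.borderInv_of_bondLaw` ∕ `hBb` of RX `RowD1FromBondLaws` and RX-M4
# `RowD1MixedDischarged`, VERBATIM), whence hR for the row literal of record `JsRowD1Pin hLc N`

b2b / pub-balaban, unit `b2b-balaban-beta-an3` gen 33 (letter supplier AN3, border chain «B», file 3b of 3), BINDER-OWNERS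
row D1 / typer row HR-W-LET.  Pure algebra: `4 × 4` rational matrices, casts `ℚ → ℝ`; no analysis, no measure, no new constants.

HONEST FRAMING. «discharging BetaPertH makes Bałaban's UV stability UNCONDITIONAL — a real constructive-QFT result; it is
NOT the continuum limit and NOT the Clay problem.»
HONEST DEPENDENCY. «continuum YM on T⁴ ⇐ BetaPertH ∧ nine spine estimates (0/9 proved); BetaPertH ⇐ (D1) ∧ (D4) ∧ CAP+tail;
G-an2-4 gates asym, D1 and NE2/3/4.»  What lands here is the LAST bond-level identity on an1's averaging tables consumed by the
hR end of row D1 (the mixed one is 33M4 `RootedMixedTableLaw.bondLaw`); §5 then reads off hR — ONE of the four binders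
(hW, hR, D1Tel, D1Rep) of `OneStepKernelFamily.d1Drift_of_D1Tel_D1Rep` for the literal of record — from leaf-05's RX-M4 socket.
The Ward letters (hW), `D1Tel`, `D1Rep` are NOT touched: hR is 1 of 4 binders for THAT literal (`JsRowD1Pin`); the trigger literal
`JsBalBmNAtOf` is untouched pending (R45).  NOT D1, NOT BetaPertH.

## Content (all `[folklore]`: entries of 33K1's single-letter identities in the path algebra of `0 → 1 → 2 → 3`)

Letters: fluctuation `E₂₃` on the bond `F`, backgrounds `E₀₁` on `G`, `E₁₂` on `H`; the `(0,3)` entry reads the coefficient of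
the word `E₀₁E₁₂E₂₃`, i.e. `vh2Tab ρ L μ y F G H` (an1 `AveragingMixedJetTables.vh2Tab`).  Write `ℓ = L^d`, `Z = linCountAt`,
`v = vhCountAt`, `h = hessCountAt`, `χ_GF = [F = G ∧ F on the axis]`, `χ_HF` likewise.
* §1 letter algebra; §2 the components of 33I's `CT`, `NR`, `CJ` at these letters as `scalar • E_{ij}` (33K1 §3) and the
  `(0,3)` ENTRIES: `CT(B,B′)₀₃ = −(2ℓ²)⁻¹ χ_HF v(F,G)`, `CT(B′,B)₀₃ = the same + ℓ⁻¹ χ_GF χ_HF Z_F`, `CJ(B,B′)₀₃`, `CJ(B′,B)₀₃`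
  (sum `= ℓ⁻³ Z_G v(F,H) − 2ℓ⁻² χ_HF Z_F Z_G − ℓ⁻² Z_F h(G,H) + ℓ⁻³ Z_F Z_G Z_H` by `h(H,G) = −h(G,H)`, `h(G,G) = 0`);
* §3 THE PER-ORDERING ℚ LAW `vh2Tab_bref`: `s_{(μ, bref α μ y)}(f; g, h) = ε_μ ς_f ς_g ς_h · (s_{(μ,y)}(f♯; g♯, h♯) + contact
  + [μ = α]·(…))` (33K1 `T2At_bref`, `T2At_upF_single_signs`, `R1g_single_signed`, §2; `f♯ = fref α f`, `ς` = MX3's signs);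
* §4 **`bondLaw (hLc : Odd Lc)`** = `hB` ∕ `hBb` VERBATIM (d = 4, root `toSite (ctrOff 4 Lc) = ctr 4 Lc`, BOTH orderings of §3
  summed — the `(g,h)`-odd remainder `−ℓ⁻² Z_F h(G,H)` cancels only in the sum — casts `ℚ → ℝ`);
* §5 COROLLARIES BY NAME: hR `∀ j, AxisReflectionCovariant (flipK (TbalOf Lc (JsRowD1Pin hLc N) j))` under `Odd Lc`, `2 ≤ N`
  (RX-M4 `…_JsRowD1Pin_of_borderBondLaw`; BX2's `borderInv_of_bondLaw` inside), and the `cΛ`-general `JsRowD1` one at the Λ-lock.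

## What is NOT here
No Ward identity (hW), no `D1Tel`∕`D1Rep`, no weight `cB`∕`cΛ` (the law is weight-free; weights live in the consumers'
displayed statements), no estimate; nothing about `BetaPertH` beyond the HONEST DEPENDENCY line.
-/

namespace Summit.QuantumFields.BalabanUV.Beta.RootedBorderTableLaw

open Literature.MathematicalPhysics.QuantumFieldTheory.Balaban1983to89
open Literature.MathematicalPhysics.QuantumFieldTheory.Balaban1983to89.Beta
open AffineAveraging (Form1 toSite)
open AveragingContoursRooted (ctr ctrOff)
open AveragingHessianKernels (Bond single)
open AveragingHessianKernelsRooted (linCountAt hessCountAt vhCountAt hessCountAt_swap hessCountAt_self vhKerAt linKerAt)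
open AveragingThirdJet (upF)
open AveragingThirdJet.Tau (c00 c10 c01 c11)
open AveragingMixedJetTables (QjetAt T2At UT E vh2Tab vh2KerAt)
open PolarizationSign (reflSign AxisReflectionCovariant)
open ResolventReflection (bref bref_bref)
open RootedKernelReflection (fref fref_fst fref_injective)
open OneStepKernelFamily (TbalOf flipK)
open Summit.QuantumFields.BalabanUV.Beta.RowD1JointEnd (JsRowD1 JsRowD1Pin)
open Summit.QuantumFields.BalabanUV.Beta.RowD1MixedDischarged (axisReflectionCovariant_flipK_TbalOf_JsRowD1_of_borderBondLaw
  axisReflectionCovariant_flipK_TbalOf_JsRowD1Pin_of_borderBondLaw)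
open Summit.QuantumFields.BalabanUV.Beta.RootedHolonomyReflection (R1g)
open Summit.QuantumFields.BalabanUV.Beta.RootedJetReflectionExpanded (ad1R)
open Summit.QuantumFields.BalabanUV.Beta.RootedT2JetReflection (CT NR CJ)
open Summit.QuantumFields.BalabanUV.Beta.RootedT2JetDictionary (R1g_upF)
open Summit.QuantumFields.BalabanUV.Beta.RootedMixedTableLaw (fref_mk)
open Summit.QuantumFields.BalabanUV.Beta.RootedT2JetSingle (T2At_bref CT_of_single c10_NR_of_single c01_NR_of_single c11_NR_of_single
  X00_of_single X01_of_single X10_of_single T2At_upF_single_signs R1g_single_signed)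

/-! ## §1 The letters -/

/-- [folklore] `[E₀₁, E₂₃] = 0`. -/
theorem comm_E01_E23 : AveragingHessianKernels.comm (E 0 1) (E 2 3) = 0 := by
  simp [AveragingHessianKernels.comm, E]

/-- [folklore] `[E₂₃, E₀₁] = 0`. -/
theorem comm_E23_E01 : AveragingHessianKernels.comm (E 2 3) (E 0 1) = 0 := by
  simp [AveragingHessianKernels.comm, E]

/-- [folklore] `[E₁₂, E₂₃] = E₁₃`. -/
theorem comm_E12_E23 : AveragingHessianKernels.comm (E 1 2) (E 2 3) = E 1 3 := by
  simp [AveragingHessianKernels.comm, E]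

/-- [folklore] `[E₂₃, E₁₂] = −E₁₃`. -/
theorem comm_E23_E12 : AveragingHessianKernels.comm (E 2 3) (E 1 2) = -E 1 3 := by
  simp [AveragingHessianKernels.comm, E]

/-- [folklore] `[E₀₁, E₁₂] = E₀₂`. -/
theorem comm_E01_E12 : AveragingHessianKernels.comm (E 0 1) (E 1 2) = E 0 2 := by
  simp [AveragingHessianKernels.comm, E]

/-- [folklore] `[E₁₂, E₀₁] = −E₀₂`. -/
theorem comm_E12_E01 : AveragingHessianKernels.comm (E 1 2) (E 0 1) = -E 0 2 := by
  simp [AveragingHessianKernels.comm, E]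

/-- [folklore] `E₀₁E₁₂ = E₀₂`. -/
theorem E01_mul_E12 : E 0 1 * E 1 2 = E 0 2 := by
  simp [E]

/-- [folklore] `E₁₂E₀₁ = 0`. -/
theorem E12_mul_E01 : E 1 2 * E 0 1 = 0 := by
  simp [E]

/-! ## §2 Components and their `(0,3)` entries -/

section Pieces

variable {d L : ℕ} (hL : (L : ℚ) ≠ 0) (ρ : Fin d → ℤ) {α : Fin d} {W B B' : Form1 d UT} {F G H : Bond d}
include hL

/-- [folklore] `c10 NR = (ℓ⁻¹ Z_G) • P` at a single first background letter `P` (33K1 `c10_NR_of_single`). -/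
theorem c10_NR_E {P : UT} (hB : R1g α B = single G P) (B' : Form1 d UT) (μ : Fin d) (y : Fin d → ℤ) :
    c10 (NR ℚ ρ α B B' L μ y) = (((L : ℚ) ^ d)⁻¹ * linCountAt ρ L μ y G) • P := by
  rw [c10_NR_of_single hL ρ hB B' μ y, ← Int.cast_smul_eq_zsmul ℚ, smul_smul]

/-- [folklore] `c01 NR = (ℓ⁻¹ Z_H) • Q` at a single second background letter `Q` (33K1 `c01_NR_of_single`). -/
theorem c01_NR_E {Q : UT} (hB' : R1g α B' = single H Q) (B : Form1 d UT) (μ : Fin d) (y : Fin d → ℤ) :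
    c01 (NR ℚ ρ α B B' L μ y) = (((L : ℚ) ^ d)⁻¹ * linCountAt ρ L μ y H) • Q := by
  rw [c01_NR_of_single hL ρ hB' B μ y, ← Int.cast_smul_eq_zsmul ℚ, smul_smul]

/-- [folklore] `c11 NR(B,B′) = ν • E₀₂` for the letters `E₀₁` on `G`, `E₁₂` on `H` (33K1 `c11_NR_of_single`, §1). -/
theorem c11_NR_E (hB : R1g α B = single G (E 0 1)) (hB' : R1g α B' = single H (E 1 2)) (μ : Fin d) (y : Fin d → ℤ) :
    c11 (NR ℚ ρ α B B' L μ y)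
      = (((2 : ℚ) * (L : ℚ) ^ d)⁻¹ * (hessCountAt ρ L μ y G H + (if G = H then (1 : ℚ) else 0) * linCountAt ρ L μ y G)
          - ((L : ℚ) ^ d)⁻¹ * ((if G = H ∧ G.1 = α then (1 : ℚ) else 0) * linCountAt ρ L μ y G)
          + ((2 : ℚ) * (L : ℚ) ^ (2 * d))⁻¹ * (linCountAt ρ L μ y G * linCountAt ρ L μ y H)) • E 0 2 := by
  rw [c11_NR_of_single hL two_ne_zero ρ hB hB' μ y, comm_E01_E12, comm_E12_E01]
  simp only [← Int.cast_smul_eq_zsmul ℚ, smul_mul_assoc, mul_smul_comm, E01_mul_E12, E12_mul_E01, smul_zero, add_zero]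
  by_cases hGH : G = H
  · by_cases hGa : G.1 = α
    · simp only [if_pos hGH, if_pos (show G = H ∧ G.1 = α from ⟨hGH, hGa⟩)]
      module
    · simp only [if_pos hGH, if_neg (show ¬(G = H ∧ G.1 = α) from fun h => hGa h.2)]
      module
  · simp only [if_neg hGH, if_neg (show ¬(G = H ∧ G.1 = α) from fun h => hGH h.1)]
    module

/-- [folklore] `c11 NR(B′,B) = ν′ • E₀₂` for the same letters, backgrounds in the other order. -/
theorem c11_NR_E' (hB : R1g α B = single G (E 0 1)) (hB' : R1g α B' = single H (E 1 2)) (μ : Fin d) (y : Fin d → ℤ) :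
    c11 (NR ℚ ρ α B' B L μ y)
      = (-(((2 : ℚ) * (L : ℚ) ^ d)⁻¹ * (hessCountAt ρ L μ y H G + (if H = G then (1 : ℚ) else 0) * linCountAt ρ L μ y H))
          + ((L : ℚ) ^ d)⁻¹ * ((if H = G ∧ H.1 = α then (1 : ℚ) else 0) * linCountAt ρ L μ y H)
          + ((2 : ℚ) * (L : ℚ) ^ (2 * d))⁻¹ * (linCountAt ρ L μ y G * linCountAt ρ L μ y H)) • E 0 2 := by
  rw [c11_NR_of_single hL two_ne_zero ρ hB' hB μ y, comm_E01_E12, comm_E12_E01]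
  simp only [← Int.cast_smul_eq_zsmul ℚ, smul_mul_assoc, mul_smul_comm, E01_mul_E12, E12_mul_E01, smul_zero, zero_add]
  by_cases hHG : H = G
  · by_cases hHa : H.1 = α
    · simp only [if_pos hHG, if_pos (show H = G ∧ H.1 = α from ⟨hHG, hHa⟩)]
      module
    · simp only [if_pos hHG, if_neg (show ¬(H = G ∧ H.1 = α) from fun h => hHa h.2)]
      module
  · simp only [if_neg hHG, if_neg (show ¬(H = G ∧ H.1 = α) from fun h => hHG h.1)]
    module

/-- [folklore] `X₀₀ = (ℓ⁻¹ Z_F) • E₂₃` (33K1 `X00_of_single`). -/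
theorem X00_E (hW : R1g α W = single F (E 2 3)) (B B' : Form1 d UT) (μ : Fin d) (y : Fin d → ℤ) :
    c00 (QjetAt ℚ ρ (R1g α (upF W)) (R1g α B) (R1g α B') L μ y) = (((L : ℚ) ^ d)⁻¹ * linCountAt ρ L μ y F) • E 2 3 := by
  rw [X00_of_single hL ρ hW B B' μ y, ← Int.cast_smul_eq_zsmul ℚ, smul_smul]

/-- [folklore] `X₀₁(B,B′) = ξ • E₁₃`, `ξ = −(2ℓ²)⁻¹ v(F,H) + ℓ⁻¹ χ_HF Z_F` (33K1 `X01_of_single`, §1). -/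
theorem X01_E (hW : R1g α W = single F (E 2 3)) (hB' : R1g α B' = single H (E 1 2)) (B : Form1 d UT) (μ : Fin d)
    (y : Fin d → ℤ) :
    c01 (QjetAt ℚ ρ (R1g α (upF W)) (R1g α B) (R1g α B') L μ y) + c00 (QjetAt ℚ ρ (ad1R α (upF W) B') (R1g α B) (R1g α B') L μ y)
      = (-(((2 : ℚ) * (L : ℚ) ^ (2 * d))⁻¹ * vhCountAt ρ L μ y F H)
          + ((L : ℚ) ^ d)⁻¹ * ((if F = H ∧ F.1 = α then (1 : ℚ) else 0) * linCountAt ρ L μ y F)) • E 1 3 := by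
  rw [X01_of_single hL two_ne_zero ρ hW hB' B μ y, comm_E23_E12, comm_E12_E23]
  by_cases h : F = H ∧ F.1 = α
  · simp only [if_pos h]
    simp [← Int.cast_smul_eq_zsmul ℚ, smul_smul]
    module
  · simp only [if_neg h]
    simp [← Int.cast_smul_eq_zsmul ℚ, smul_smul]

/-- [folklore] `X₁₀(B,B′) = 0` for these letters (`[E₂₃, E₀₁] = [E₀₁, E₂₃] = 0`; 33K1 `X10_of_single`). -/
theorem X10_E (hW : R1g α W = single F (E 2 3)) (hB : R1g α B = single G (E 0 1)) (B' : Form1 d UT) (μ : Fin d)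
    (y : Fin d → ℤ) :
    c10 (QjetAt ℚ ρ (R1g α (upF W)) (R1g α B) (R1g α B') L μ y) + c00 (QjetAt ℚ ρ (ad1R α (upF W) B) (R1g α B) (R1g α B') L μ y)
      = 0 := by
  rw [X10_of_single hL two_ne_zero ρ hW hB B' μ y, comm_E23_E01, comm_E01_E23]
  simp

/-- [folklore] `X₀₁(B′,B) = 0` (backgrounds in the other order). -/
theorem X01_E' (hW : R1g α W = single F (E 2 3)) (hB : R1g α B = single G (E 0 1)) (B' : Form1 d UT) (μ : Fin d)
    (y : Fin d → ℤ) :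
    c01 (QjetAt ℚ ρ (R1g α (upF W)) (R1g α B') (R1g α B) L μ y) + c00 (QjetAt ℚ ρ (ad1R α (upF W) B) (R1g α B') (R1g α B) L μ y)
      = 0 := by
  rw [X01_of_single hL two_ne_zero ρ hW hB B' μ y, comm_E23_E01, comm_E01_E23]
  simp

/-- [folklore] `X₁₀(B′,B) = ξ • E₁₃` (backgrounds in the other order). -/
theorem X10_E' (hW : R1g α W = single F (E 2 3)) (hB' : R1g α B' = single H (E 1 2)) (B : Form1 d UT) (μ : Fin d)
    (y : Fin d → ℤ) :
    c10 (QjetAt ℚ ρ (R1g α (upF W)) (R1g α B') (R1g α B) L μ y) + c00 (QjetAt ℚ ρ (ad1R α (upF W) B') (R1g α B') (R1g α B) L μ y)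
      = (-(((2 : ℚ) * (L : ℚ) ^ (2 * d))⁻¹ * vhCountAt ρ L μ y F H)
          + ((L : ℚ) ^ d)⁻¹ * ((if F = H ∧ F.1 = α then (1 : ℚ) else 0) * linCountAt ρ L μ y F)) • E 1 3 := by
  rw [X10_of_single hL two_ne_zero ρ hW hB' B μ y, comm_E23_E12, comm_E12_E23]
  by_cases h : F = H ∧ F.1 = α
  · simp only [if_pos h]
    simp [← Int.cast_smul_eq_zsmul ℚ, smul_smul]
    module
  · simp only [if_neg h]
    simp [← Int.cast_smul_eq_zsmul ℚ, smul_smul]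

/-- [folklore] THE ENTRY `CT(B,B′)₀₃ = −(2ℓ²)⁻¹ χ_HF v(F,G)` (33K1 `CT_of_single`, §1). -/
theorem CT_entry (hW : R1g α W = single F (E 2 3)) (hB : R1g α B = single G (E 0 1)) (hB' : R1g α B' = single H (E 1 2))
    (μ : Fin d) (y : Fin d → ℤ) :
    CT ℚ ρ α (upF W) B B' L μ y 0 3
      = -(((2 : ℚ) * (L : ℚ) ^ (2 * d))⁻¹ * ((if F = H ∧ F.1 = α then (1 : ℚ) else 0) * vhCountAt ρ L μ y F G)) := by
  rw [CT_of_single hL two_ne_zero ρ hW hB hB' μ y, comm_E01_E23, comm_E12_E23]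
  by_cases h : F = H ∧ F.1 = α
  · simp only [if_pos h]
    simp [AveragingHessianKernels.comm, E, ← Int.cast_smul_eq_zsmul ℚ]
  · simp only [if_neg h]
    simp [AveragingHessianKernels.comm]

/-- [folklore] THE ENTRY `CT(B′,B)₀₃ = −(2ℓ²)⁻¹ χ_HF v(F,G) + ℓ⁻¹ χ_GF χ_HF Z_F`. -/
theorem CT_entry' (hW : R1g α W = single F (E 2 3)) (hB : R1g α B = single G (E 0 1)) (hB' : R1g α B' = single H (E 1 2))
    (μ : Fin d) (y : Fin d → ℤ) :
    CT ℚ ρ α (upF W) B' B L μ y 0 3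
      = -(((2 : ℚ) * (L : ℚ) ^ (2 * d))⁻¹ * ((if F = H ∧ F.1 = α then (1 : ℚ) else 0) * vhCountAt ρ L μ y F G))
        + ((L : ℚ) ^ d)⁻¹
          * ((if F = G ∧ F.1 = α then (1 : ℚ) else 0) * (if F = H ∧ F.1 = α then (1 : ℚ) else 0) * linCountAt ρ L μ y F) := by
  rw [CT_of_single hL two_ne_zero ρ hW hB' hB μ y, comm_E01_E23, comm_E12_E23]
  by_cases hH : F = H ∧ F.1 = α
  · by_cases hG : F = G ∧ F.1 = α
    · simp only [if_pos hH, if_pos hG, if_pos (show F = H ∧ F = G ∧ F.1 = α from ⟨hH.1, hG.1, hH.2⟩)]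
      simp [AveragingHessianKernels.comm, E, ← Int.cast_smul_eq_zsmul ℚ]
    · simp only [if_pos hH, if_neg hG, if_neg (show ¬(F = H ∧ F = G ∧ F.1 = α) from fun h => hG ⟨h.2.1, h.2.2⟩)]
      simp [AveragingHessianKernels.comm, E, ← Int.cast_smul_eq_zsmul ℚ]
  · simp only [if_neg hH, if_neg (show ¬(F = H ∧ F = G ∧ F.1 = α) from fun h => hH ⟨h.1, h.2.2⟩)]
    simp [AveragingHessianKernels.comm]

/-- [folklore] THE ENTRY `CJ(B,B′)₀₃` (33I `CJ` written out, §2 components, words evaluated in the path algebra). -/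
theorem CJ_entry (hW : R1g α W = single F (E 2 3)) (hB : R1g α B = single G (E 0 1)) (hB' : R1g α B' = single H (E 1 2))
    (μ : Fin d) (y : Fin d → ℤ) :
    CJ ℚ ρ α (upF W) B B' L μ y 0 3
      = ((L : ℚ) ^ d)⁻¹ * linCountAt ρ L μ y G
            * ((((2 : ℚ) * (L : ℚ) ^ (2 * d))⁻¹ * vhCountAt ρ L μ y F H)
                - ((L : ℚ) ^ d)⁻¹ * ((if F = H ∧ F.1 = α then (1 : ℚ) else 0) * linCountAt ρ L μ y F))
        - ((L : ℚ) ^ d)⁻¹ * linCountAt ρ L μ y F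
            * (((2 : ℚ) * (L : ℚ) ^ d)⁻¹ * (hessCountAt ρ L μ y G H + (if G = H then (1 : ℚ) else 0) * linCountAt ρ L μ y G)
                - ((L : ℚ) ^ d)⁻¹ * ((if G = H ∧ G.1 = α then (1 : ℚ) else 0) * linCountAt ρ L μ y G)
                + ((2 : ℚ) * (L : ℚ) ^ (2 * d))⁻¹ * (linCountAt ρ L μ y G * linCountAt ρ L μ y H))
        + (((L : ℚ) ^ d)⁻¹) ^ 3 * linCountAt ρ L μ y F * linCountAt ρ L μ y G * linCountAt ρ L μ y H := by
  rw [CJ, X01_E hL ρ hW hB' B μ y, X10_E hL ρ hW hB B' μ y, X00_E hL ρ hW B B' μ y, c10_NR_E hL ρ hB B' μ y,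
    c01_NR_E hL ρ hB' B μ y, c11_NR_E hL ρ hB hB' μ y]
  simp [E]
  ring

/-- [folklore] THE ENTRY `CJ(B′,B)₀₃` (backgrounds in the other order). -/
theorem CJ_entry' (hW : R1g α W = single F (E 2 3)) (hB : R1g α B = single G (E 0 1)) (hB' : R1g α B' = single H (E 1 2))
    (μ : Fin d) (y : Fin d → ℤ) :
    CJ ℚ ρ α (upF W) B' B L μ y 0 3
      = ((L : ℚ) ^ d)⁻¹ * linCountAt ρ L μ y G
            * ((((2 : ℚ) * (L : ℚ) ^ (2 * d))⁻¹ * vhCountAt ρ L μ y F H)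
                - ((L : ℚ) ^ d)⁻¹ * ((if F = H ∧ F.1 = α then (1 : ℚ) else 0) * linCountAt ρ L μ y F))
        - ((L : ℚ) ^ d)⁻¹ * linCountAt ρ L μ y F
            * (-(((2 : ℚ) * (L : ℚ) ^ d)⁻¹ * (hessCountAt ρ L μ y H G + (if H = G then (1 : ℚ) else 0) * linCountAt ρ L μ y H))
                + ((L : ℚ) ^ d)⁻¹ * ((if H = G ∧ H.1 = α then (1 : ℚ) else 0) * linCountAt ρ L μ y H)
                + ((2 : ℚ) * (L : ℚ) ^ (2 * d))⁻¹ * (linCountAt ρ L μ y G * linCountAt ρ L μ y H))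
        + (((L : ℚ) ^ d)⁻¹) ^ 3 * linCountAt ρ L μ y F * linCountAt ρ L μ y G * linCountAt ρ L μ y H := by
  rw [CJ, X01_E' hL ρ hW hB B' μ y, X10_E' hL ρ hW hB' B μ y, X00_E hL ρ hW B' B μ y, c10_NR_E hL ρ hB' B μ y,
    c01_NR_E hL ρ hB B' μ y, c11_NR_E' hL ρ hB hB' μ y]
  simp [E]
  ring

end Pieces

/-! ## §3 The per-ordering ℚ law -/

/-- [folklore] **THE BORDER TABLE UNDER THE REFLECTION OF AXIS `α`, ONE ORDERING OF THE BACKGROUNDS** (33K1 `T2At_bref` at the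
signed single letters, `T2At_upF_single_signs`, `R1g_single_signed`, §2's entries; `f♯ = fref α f`):
`s_{(μ, bref α μ y)}(f; g, h) = ε_μ ς_f ς_g ς_h · (s_{(μ,y)}(f♯; g♯, h♯) − ℓ⁻² χ_HF v(f♯,g♯) + ℓ⁻¹ χ_GF χ_HF Z_{f♯} + [μ = α]·(ℓ⁻³ Z_{g♯}
v(f♯,h♯) − 2ℓ⁻² χ_HF Z_{f♯} Z_{g♯} − ℓ⁻² Z_{f♯} h(g♯,h♯) + ℓ⁻³ Z_{f♯} Z_{g♯} Z_{h♯}))`.  The `(g,h)`-ODD term `−ℓ⁻² Z h(g♯,h♯)` is why only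
the `(g,h)`-symmetrised law (§4) is the one of BX2. -/
theorem vh2Tab_bref {d L : ℕ} (hL : Odd L) (α μ : Fin d) (f g h : Bond d) (y : Fin d → ℤ) :
    vh2Tab (ctr d L) L μ (bref α μ y) f g h
      = ((if μ = α then -1 else 1 : ℚ)
          * ((if f.1 = α then -1 else 1 : ℚ) * (if g.1 = α then -1 else 1 : ℚ) * (if h.1 = α then -1 else 1 : ℚ)))
        * (vh2Tab (ctr d L) L μ y (fref α f) (fref α g) (fref α h)
            - ((L : ℚ) ^ (2 * d))⁻¹ * ((if fref α f = fref α h ∧ f.1 = α then (1 : ℚ) else 0)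
                * vhCountAt (ctr d L) L μ y (fref α f) (fref α g))
            + ((L : ℚ) ^ d)⁻¹ * ((if fref α f = fref α g ∧ f.1 = α then (1 : ℚ) else 0)
                * (if fref α f = fref α h ∧ f.1 = α then (1 : ℚ) else 0) * linCountAt (ctr d L) L μ y (fref α f))
            + (if μ = α then
                (((L : ℚ) ^ d)⁻¹) ^ 3 * linCountAt (ctr d L) L μ y (fref α g) * vhCountAt (ctr d L) L μ y (fref α f) (fref α h)
                  - 2 * (((L : ℚ) ^ d)⁻¹) ^ 2 * ((if fref α f = fref α h ∧ f.1 = α then (1 : ℚ) else 0)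
                      * linCountAt (ctr d L) L μ y (fref α f) * linCountAt (ctr d L) L μ y (fref α g))
                  - (((L : ℚ) ^ d)⁻¹) ^ 2 * linCountAt (ctr d L) L μ y (fref α f) * hessCountAt (ctr d L) L μ y (fref α g) (fref α h)
                  + (((L : ℚ) ^ d)⁻¹) ^ 3 * linCountAt (ctr d L) L μ y (fref α f) * linCountAt (ctr d L) L μ y (fref α g)
                      * linCountAt (ctr d L) L μ y (fref α h)
               else 0)) := by
  have hL0 : (L : ℚ) ≠ 0 := Nat.cast_ne_zero.2 hL.pos.ne'
  have hW : R1g α (single f (if f.1 = α then -E 2 3 else E 2 3)) = single (fref α f) (E 2 3) := R1g_single_signed α f (E 2 3)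
  have hB : R1g α (single g (if g.1 = α then -E 0 1 else E 0 1)) = single (fref α g) (E 0 1) := R1g_single_signed α g (E 0 1)
  have hB' : R1g α (single h (if h.1 = α then -E 1 2 else E 1 2)) = single (fref α h) (E 1 2) := R1g_single_signed α h (E 1 2)
  have law := T2At_bref ℚ hL two_ne_zero α μ (upF (single f (if f.1 = α then -E 2 3 else E 2 3)))
    (single g (if g.1 = α then -E 0 1 else E 0 1)) (single h (if h.1 = α then -E 1 2 else E 1 2)) y
  rw [R1g_upF, hW, hB, hB', T2At_upF_single_signs] at law
  have sq : ((if f.1 = α then -1 else 1 : ℚ) * (if g.1 = α then -1 else 1 : ℚ) * (if h.1 = α then -1 else 1 : ℚ))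
      * ((if f.1 = α then -1 else 1 : ℚ) * (if g.1 = α then -1 else 1 : ℚ) * (if h.1 = α then -1 else 1 : ℚ)) = 1 := by
    split_ifs <;> norm_num
  simp only [vh2Tab]
  by_cases hμ : μ = α
  · rw [if_pos hμ, if_pos hμ] at law
    have e := congrArg (fun M : UT => M 0 3) law
    simp only [Matrix.smul_apply, Matrix.add_apply, zsmul_eq_mul] at e
    push_cast at e
    rw [CT_entry hL0 _ hW hB hB', CT_entry' hL0 _ hW hB hB', CJ_entry hL0 _ hW hB hB', CJ_entry' hL0 _ hW hB hB'] at e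
    simp only [fref_fst] at e
    have e' := congrArg
      (fun t => ((if f.1 = α then -1 else 1 : ℚ) * (if g.1 = α then -1 else 1 : ℚ) * (if h.1 = α then -1 else 1 : ℚ)) * t) e
    rw [← mul_assoc, sq, one_mul] at e'
    rw [e', if_pos hμ, if_pos hμ]
    by_cases hGH : fref α g = fref α h
    · obtain rfl : g = h := fref_injective α hGH
      simp only [if_pos trivial, true_and, hessCountAt_self]
      ring
    · have hHG : ¬fref α h = fref α g := fun e => hGH e.symm
      simp only [if_neg hGH, if_neg hHG, if_neg (show ¬(fref α g = fref α h ∧ g.1 = α) from fun hh => hGH hh.1),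
        if_neg (show ¬(fref α h = fref α g ∧ h.1 = α) from fun hh => hHG hh.1),
        hessCountAt_swap (ctr d L) L μ y (fref α g) (fref α h)]
      push_cast
      ring
  · rw [if_neg hμ, if_neg hμ, add_zero] at law
    have e := congrArg (fun M : UT => M 0 3) law
    simp only [Matrix.smul_apply, Matrix.add_apply, zsmul_eq_mul] at e
    push_cast at e
    rw [CT_entry hL0 _ hW hB hB', CT_entry' hL0 _ hW hB hB'] at e
    simp only [fref_fst] at e
    have e' := congrArg
      (fun t => ((if f.1 = α then -1 else 1 : ℚ) * (if g.1 = α then -1 else 1 : ℚ) * (if h.1 = α then -1 else 1 : ℚ)) * t) e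
    rw [← mul_assoc, sq, one_mul] at e'
    rw [e', if_neg hμ, if_neg hμ]
    ring

/-! ## §4 The bond-level border law `hB` of BX2 ∕ `hBb` of RX -/

/-- [folklore] The contact guard in bond language and in an1's letters agree. -/
theorem contact_iff' {D : ℕ} (α β κ : Fin D) (x u : Fin D → ℤ) : ((β, x) = (κ, u) ∧ β = α) ↔ (x = u ∧ β = κ ∧ κ = α) := by
  constructor
  · rintro ⟨h, hβ⟩
    simp only [Prod.mk.injEq] at h
    exact ⟨h.2, h.1, h.1.symm.trans hβ⟩
  · rintro ⟨hx, rfl, hβ⟩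
    exact ⟨by rw [hx], hβ⟩

variable {Lc : ℕ}

open Classical in
/-- [folklore] **an1's `(g,h)`-SYMMETRISED BOND-LEVEL BORDER REFLECTION LAW** — the hypothesis `hB` of BX2
`BorderLetterPacking.borderInv_of_bondLaw` ∕ `hBb` of RX `RowD1FromBondLaws.axisReflectionCovariant_flipK_TbalOf_JsRowD1_of_bondLaws`,
VERBATIM, for every odd `Lc` (§3 at `d = 4` for both orderings of the backgrounds, root `toSite (ctrOff 4 Lc) = ctr 4 Lc`,
`h(G,H) = −h(H,G)`, casts `ℚ → ℝ`). -/
theorem bondLaw (hLc : Odd Lc) :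
    ∀ (α m : Fin 4) (y : Fin 4 → ℤ) (β : Fin 4) (x : Fin 4 → ℤ) (κ : Fin 4) (u : Fin 4 → ℤ) (κ' : Fin 4) (u' : Fin 4 → ℤ),
      reflSign α β * reflSign α κ * reflSign α κ' * reflSign α m *
          (vh2KerAt (toSite (ctrOff 4 Lc)) Lc m (bref α m y) (β, bref α β x) (κ, bref α κ u) (κ', bref α κ' u')
            + vh2KerAt (toSite (ctrOff 4 Lc)) Lc m (bref α m y) (β, bref α β x) (κ', bref α κ' u') (κ, bref α κ u))
        = (vh2KerAt (toSite (ctrOff 4 Lc)) Lc m y (β, x) (κ, u) (κ', u') + vh2KerAt (toSite (ctrOff 4 Lc)) Lc m y (β, x) (κ', u') (κ, u))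
          + 2 * (vhKerAt (toSite (ctrOff 4 Lc)) Lc m y (β, x) (κ', u')
                  * ((if m = α then linKerAt (toSite (ctrOff 4 Lc)) Lc m y (κ, u) else 0) - (if x = u ∧ β = κ ∧ κ = α then 1 else 0))
                + vhKerAt (toSite (ctrOff 4 Lc)) Lc m y (β, x) (κ, u)
                  * ((if m = α then linKerAt (toSite (ctrOff 4 Lc)) Lc m y (κ', u') else 0) - (if x = u' ∧ β = κ' ∧ κ' = α then 1 else 0))
                + linKerAt (toSite (ctrOff 4 Lc)) Lc m y (β, x)
                  * ((if m = α then linKerAt (toSite (ctrOff 4 Lc)) Lc m y (κ, u) else 0) - (if x = u ∧ β = κ ∧ κ = α then 1 else 0))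
                  * ((if m = α then linKerAt (toSite (ctrOff 4 Lc)) Lc m y (κ', u') else 0) - (if x = u' ∧ β = κ' ∧ κ' = α then 1 else 0))) := by
  intro α m y β x κ u κ' u'
  have e1 := vh2Tab_bref (d := 4) hLc α m (β, bref α β x) (κ, bref α κ u) (κ', bref α κ' u') y
  have e2 := vh2Tab_bref (d := 4) hLc α m (β, bref α β x) (κ', bref α κ' u') (κ, bref α κ u) y
  simp only [fref_mk, bref_bref, contact_iff'] at e1 e2
  rw [show toSite (ctrOff 4 Lc) = ctr 4 Lc from rfl]
  simp only [vh2KerAt, vhKerAt, linKerAt, reflSign, e1, e2, hessCountAt_swap (ctr 4 Lc) Lc m y (κ, u) (κ', u')]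
  split_ifs <;> push_cast <;> ring

/-! ## §5 Corollaries: hR for the row literal (RX-M4 sockets, BY NAME) -/

/-- [folklore] **hR FOR THE PINNED ROW LITERAL OF RECORD `JsRowD1Pin hLc N`**: leaf-05's RX-M4 socket
`RowD1MixedDischarged.axisReflectionCovariant_flipK_TbalOf_JsRowD1Pin_of_borderBondLaw` (mixed law 33M4 inside, Λ-lock `lockΛ_pin`) with its
ONE hypothesis `hBb` supplied by §4: hypotheses `Odd Lc` and `2 ≤ N` only.  This is the hR binder (one of the four: hW, hR, D1Tel, D1Rep) of
`OneStepKernelFamily.d1Drift_of_D1Tel_D1Rep` for the literal of record; NOT D1, NOT BetaPertH. -/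
theorem axisReflectionCovariant_flipK_TbalOf_JsRowD1Pin [NeZero Lc] (hLc : Odd Lc) {N : ℕ} (hN : 2 ≤ N) :
    ∀ j : ℕ, AxisReflectionCovariant (flipK (TbalOf Lc (JsRowD1Pin hLc N) j)) :=
  axisReflectionCovariant_flipK_TbalOf_JsRowD1Pin_of_borderBondLaw hLc hN (bondLaw hLc)

/-- [folklore] hR for the `cΛ`-general row literal `JsRowD1 hLc N cΛ (−Lc¹²∕4)` at the Λ-lock `cΛ·Lc⁴ = 2` (RX-M4
`axisReflectionCovariant_flipK_TbalOf_JsRowD1_of_borderBondLaw`, `hBb` := §4). -/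
theorem axisReflectionCovariant_flipK_TbalOf_JsRowD1 [NeZero Lc] (hLc : Odd Lc) {N : ℕ} (hN : 2 ≤ N) {cΛ : ℝ}
    (hΛ : cΛ * (Lc : ℝ) ^ 4 = 2) :
    ∀ j : ℕ, AxisReflectionCovariant (flipK (TbalOf Lc (JsRowD1 hLc N cΛ (-((Lc : ℝ) ^ 12 / 4))) j)) :=
  axisReflectionCovariant_flipK_TbalOf_JsRowD1_of_borderBondLaw hLc hN hΛ (bondLaw hLc)

end Summit.QuantumFields.BalabanUV.Beta.RootedBorderTableLaw
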